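import Summits.CriticalPhenomena.PercolationContinuityZ3.Theorems.Transplant.SkelPhiNegReachFinal
import Summits.CriticalPhenomena.PercolationContinuityZ3.Theorems.Transplant.SkelPhiNegReachGlue
import Summits.CriticalPhenomena.PercolationContinuityZ3.Theorems.Transplant.SkelNegBParamsReachT
import Summits.CriticalPhenomena.PercolationContinuityZ3.Theorems.Transplant.SkelNegBParamsSlotsSU
import Summits.CriticalPhenomena.PercolationContinuityZ3.Theorems.Transplant.SkelNegBParamsRootK
import Summits.CriticalPhenomena.PercolationContinuityZ3.Theorems.Transplant.SkelNegBParamsRootA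
import Summits.CriticalPhenomena.PercolationContinuityZ3.Theorems.Transplant.SkelNegBParamsCol
import Summits.CriticalPhenomena.PercolationContinuityZ3.Theorems.Transplant.SkelPhiRootServe
import Summits.CriticalPhenomena.PercolationContinuityZ3.Theorems.Transplant.SkelPhiRootServeTable
import Summits.CriticalPhenomena.PercolationContinuityZ3.Theorems.Transplant.SkelPhiRootNegBKit
import Summits.CriticalPhenomena.PercolationContinuityZ3.Theorems.Transplant.SkelPhiCylRadOri
import HarnessLib

/-!
# N1 (the `{±1}` node), (C) column (C-A8): **`ReachHoldsRHNOFn` OF THE CHOICE FUNCTION OF RECORD** —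
# `PlanarSkeletonNeg.reachHoldsRHNOFn_negChoiceAllOT`: for the slots of record `gv := KS.gT mk gx`, `fv := KS.fT mk fx`, `Pv := KS.PR mk Px`,
# `Sv := NegB.SU ex mx` (stmt-g14's chain `NegB`), and ANY residual functions `gx fx Px mx`, the (C) hypothesis
# `ReachHoldsRHNOFn (negChoiceAllOT gv fv Pv Sv)` of `samePDropOfSkeletonNeg₁_of_choiceFnNO` holds as soon as the residual depth slot `ex` clears two
# floors: `r₀A(Rl) + 3 ≤ ex` (the corridor kits' near/far threshold below the plain windows' depth `L′`) and `4 + 13·800·(n_L + W_B) ≤ ex` (the habitat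
# points' depth below `E₀`).  EVERYTHING ELSE IS DISCHARGED from the ledger: the corridor residue itself is `Skelφ.reachOblRHN_negSG₂b_of_floors` (C-S11,
# the one-frame corridor v-rounds ⧺ u-rounds ⧺ windowed band at the records `Skelφ.CorrRec.*`, RULING B.15 S1 + B.16 `b0T := r/4`), read through
# `NegB.choiceAtOT_reach_iff`; its five primitive floors are stmt-g14's `KS.nL_floorsT` (P1), `KS.corridor_floors_T` (P2), `NegB.aWT_le` (P3), `NegB.U_bLT_le`
# (P4), `NegB.r_le_four_b0T` (P5), the frame change `NegB.ha_T/hBx_T/hb_T`, the commensurability `NegB.hsc_R`, the lattice range `Skelφ.NegPrm.modulus_vβOf`;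
# the fine map / cells / schedule / columns of record (`fineO`, `fcells`, `schedOf (SU …)`, `offN`, `colV`), the apron kit of record (`KS.apron`, `apron_ok/sizes`,
# `hr₀/hreach_apron`, `j₀A_ge`, `rootKit_reach`, counts `KS.counts_R` at `κ.δ`), the kit pair's region and exit table (`KS.QKO`, `RgO_QKO`, `pexXO_facts_of_atQOS`,
# `Skelφ.pexXO_spec`, `Skelφ.real_pexXO_gt`), the zone family (`KS.hΛRg_of_atQOS`, `KS.hclrz_T`), ALL Step-I″ inputs at every centre (`zoneAt/inputsLAt/
# inputsExtraAt_of_atQOB`), and the excess (`NegB.hRex_U` with `fine_diam_le_mR`, `hsch_U`, `ex_le_Lp_U`, `three_le_E₀_U`, `hgap20_U/hgapc_U/hgapL_U`).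
# * §1 `NegB.reachOblRHN_negBT_SU` — the residue at one `(O, q)` for ANY box/width/pair slots, from (P1), (P2), the layer inequality, `24 ≤ ℓ_L`, the zone
#   clearance, the kit pair listed, and the two `ex` floors;
# * §2 `NegB.reachOblRHN_negBT_at` — the same at `(gT, fT, PR)`: only the two `ex` floors remain;
# * §3 **`reachHoldsRHNOFn_negChoiceAllOT`**.

builds on p205010 (kernel theorem, internal audit signed; external expert review pending) — nothing in this file uses p205010; NOTHING is claimed about the
open node `SamePDropOfSkeletonNeg`: this is its (C) hypothesis for the choice function of record, modulo two floors on the slot `ex`.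
Lane `prim-bschramm`, seat `prim-bschramm-p5` (gen 9; (C) lineage); helper file (`--supports stmt-CriticalPhenomena-4575 --as helper`).
[cite: KozmaNitzan2024, §4 Theorem 6 (pp. 25–31), Lemma 10 Steps III–V (pp. 19–22), Lemma 11 (pp. 22–23), Lemma 12 (pp. 23–25)] [cite: MartineauTassion2017, §3.2, §4.3 Lemma 4.2]
-/

noncomputable section

open scoped Classical

namespace Summit.CriticalPhenomena.PercolationContinuityZ3.Theorems.Transplant

open MeasureTheory Literature.Probability.Percolation Literature.Probability.LatticeModels SimpleGraph KNCells KNLevels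
open Literature.Barriers.CriticalPhenomena (graphBall mem_graphBall_self graphBall_mono)
open BoxProdZ2 (ConcRadiiG Erad)

namespace PlanarSkeletonNeg

open SkelConc (Consts)
open Skelφ (oriφ trφ runX RgO pexXO shearUnit pgramPrismFin pgSideHalfW pgTopPieceW)
open Skelφ.StepI (DataN OutO eventNAt)
open SkelI (tanOff)

namespace NegB

open Neg

section AtQ

variable {κ : Consts} {V : Type} [DecidableEq V] [Countable V] {G : SimpleGraph V} [G.LocallyFinite] {Φ : PlanarSkeletonNeg G} {t : V} {p : unitInterval}
  {hC : Φ.CylSubcritical p} {gv fv : Neg.FSlot} {Pv : PSlot} {ex mx : GSlot} {O : OutO V} {q : unitInterval}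

/-! ## §1 The residue at one `(O, q)`, any box / width / pair slots -/

set_option maxHeartbeats 800000 in
/-- **THE (C) RESIDUE OF THE CHOICES OF RECORD AT `(O, q)`** (fibre block `SU ex mx`, any `gv fv Pv`): `Skel.ReachOblRHN` of the scheme of record from the
primitive floors that read the slots — (P1) `2000(RA′+2) ≤ n_L`, (P2) `2000(RA′+2)·U_L ≤ n_Lℓ_L − n_L`, the layer inequality `2U_L ≤ n_Lℓ_L + 1`, `24 ≤ ℓ_L`,
the zone clearance `(M_u+4)U_L ≤ n_L(ℓ_L+1)`, the kit pair listed — and the two floors on `ex`; the slot reads are NAMED (`hg : gOf … = g`, `hf : fOf … = f`)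
so that every floor is stated at plain `(g, f)`. [cite: KozmaNitzan2024, §4 Lemmas 10–12 (pp. 17–25), p. 30 (Step IV)] -/
theorem reachOblRHN_negBT_SU (hAt : (choiceAtOT κ Φ t p gv fv (SU ex mx) hC Pv).AtQO O q) (h1 : Φ.types = {t}) (hp0 : 0 < (p : ℝ)) (hp1 : (p : ℝ) < 1)
    (mk : ℕ) (hPk : (KS.MK O.merged mk, KS.nKit O.merged mk) ∈ (Pv κ Φ t p O.merged).1)
    {g f : ℕ} (hg : gOf κ Φ t p O gv = g) (hf : fOf κ Φ t p O fv = f)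
    (P1 : 2000 * (KS.RA' κ Φ t p O.merged mk + 2) ≤ nL κ Φ t p O.merged g f)
    (P2 : 2000 * ((KS.RA' κ Φ t p O.merged mk : ℤ) + 2) * (shearUnit (nL κ Φ t p O.merged g f) (hL κ Φ t p O.merged g f) : ℤ) ≤ (nL κ Φ t p O.merged g f : ℤ) * ℓL κ Φ t p O.merged g f - nL κ Φ t p O.merged g f)
    (hlay : 2 * ((nL κ Φ t p O.merged g f + ((hL κ Φ t p O.merged g f)).natAbs : ℕ) : ℤ) ≤ (nL κ Φ t p O.merged g f : ℤ) * ℓL κ Φ t p O.merged g f + 1) (hℓ24 : 24 ≤ ℓL κ Φ t p O.merged g f)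
    (hclear : (Mu O.merged + 4) * (nL κ Φ t p O.merged g f + ((hL κ Φ t p O.merged g f)).natAbs) ≤ nL κ Φ t p O.merged g f * (ℓL κ Φ t p O.merged g f + 1))
    (hex₁ : KS.r₀A Φ t O.merged mk (O.merged.R (O.merged.scale t (ML κ Φ t p O.merged g) (nL κ Φ t p O.merged g f))) + 3 ≤ ex κ Φ t p O.merged g f)
    (hex₂ : 4 + 13 * (800 * (nL κ Φ t p O.merged g f + Skelφ.CorrRec.Qw (nL κ Φ t p O.merged g f) (ℓL κ Φ t p O.merged g f) (hL κ Φ t p O.merged g f))) ≤ ex κ Φ t p O.merged g f) :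
    Skel.ReachOblRHN G Skel.nmaxN ((choiceAtOT κ Φ t p gv fv (SU ex mx) hC Pv).scheme O q) ((choiceAtOT κ Φ t p gv fv (SU ex mx) hC Pv).FD O q) Φ.Δ κ.δ := by
  rw [choiceAtOT_reach_iff]
  obtain ⟨hF, hq1, hq2, hCq⟩ := factsO_of_atQOT hAt
  have hAtS := atQOS_of_atQOT hAt
  have hAtB := atQOB_of_atQOT hAt
  obtain ⟨hm₀k, hk1, hkM₀, hReq, hΛeq⟩ := hF.seed
  have hEqL := clauseL_of_atQOT hAt
  have hNL := eqNumL_of_atQOT hAt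
  obtain ⟨hnSK, hκSK, hℓSK⟩ := KS.pexXO_facts_of_atQOS (g := g) (f := f) mk hAtS
  have hInL := fun c fam σ τ => inputsLAt_of_atQOB hAtB h1 c fam σ τ
  -- name the slot reads (`g = gOf …`, `f = fOf …`) everywhere, then the derived long data
  rw [hg, hf] at hEqL hNL hInL ⊢
  set vβ : ℤ := Skelφ.NegPrm.vβOf (nL κ Φ t p O.merged g f) (hL κ Φ t p O.merged g f) (ℓL κ Φ t p O.merged g f) (vL κ Φ t p O.merged g f) with hvβ
  set Dof : ℤ := Skelφ.NegPrm.Dof (nL κ Φ t p O.merged g f) (hL κ Φ t p O.merged g f) (ℓL κ Φ t p O.merged g f) (vL κ Φ t p O.merged g f) with hDof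
  set Rl : ℕ := O.merged.R (O.merged.scale t (ML κ Φ t p O.merged g) (nL κ Φ t p O.merged g f)) with hRl
  obtain ⟨hnL, hℓL⟩ := one_le_of_eqNumL κ Φ t p O.merged g f hNL
  have hκL : ((hL κ Φ t p O.merged g f)).natAbs ≤ 10 * (nL κ Φ t p O.merged g f) := hEqL.2
  have hκL10 : |(hL κ Φ t p O.merged g f)| ≤ 10 * (((nL κ Φ t p O.merged g f) : ℕ) : ℤ) := by rw [← Int.natCast_natAbs]; exact_mod_cast hκL
  have hvn : |(vL κ Φ t p O.merged g f)| ≤ ((nL κ Φ t p O.merged g f) : ℤ) := hNL.v_le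
  have hlip : Skelφ.Lip G (φL κ Φ t p O.D O.DT O.ori g f) := lip_φL κ Φ t p O.D O.DT O.ori g f
  have hstep : Skelφ.Steps G (φL κ Φ t p O.D O.DT O.ori g f) := steps_φL κ Φ t p O.D O.DT O.ori g f
  have hfr : Skelφ.Frames G (φL κ Φ t p O.D O.DT O.ori g f) Φ.types := Skelφ.frames_oriφ Φ.frame _
  have hκc : Skelφ.CylConn G (φL κ Φ t p O.D O.DT O.ori g f) Φ.types := Skelφ.cylConn_oriφ Φ.cyl_connected _
  have hAf : (0 : ℤ) < 800 := by norm_num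
  have hm : 0 < TwoAxis.Para.modulus (nL κ Φ t p O.merged g f) (hL κ Φ t p O.merged g f) (vL κ Φ t p O.merged g f) vβ := Skelφ.NegPrm.modulus_vβOf_pos hnL hℓL _ _
  obtain ⟨hΔlo, hΔhi⟩ := Skelφ.NegPrm.modulus_vβOf hnL (hL κ Φ t p O.merged g f) (ℓL κ Φ t p O.merged g f) (vL κ Φ t p O.merged g f)
  obtain ⟨hc0, hc1⟩ := prF_c_pos κ Φ t p O.merged g f
  have hc0' : (0 : ℤ) < 20 * ((fcells κ Φ t p O.merged g f).K : ℤ) * (((fcells κ Φ t p O.merged g f).s 0 : ℕ) : ℤ) := hc0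
  have hc1' : (0 : ℤ) < 20 * ((fcells κ Φ t p O.merged g f).K : ℤ) * (((fcells κ Φ t p O.merged g f).s 1 : ℕ) : ℤ) := hc1
  have hDf : 0 < Dof := Skelφ.NegPrm.Dof_pos hnL hℓL _ _
  -- ### the fine map of record
  have hfine : fineO κ Φ t p O.D O.DT O.ori g f =
      Skelφ.fineSkel (φL κ Φ t p O.D O.DT O.ori g f) t 800 (nL κ Φ t p O.merged g f) (hL κ Φ t p O.merged g f) (vL κ Φ t p O.merged g f) vβ (20 * ((fcells κ Φ t p O.merged g f).K : ℤ) * (((fcells κ Φ t p O.merged g f).s 0 : ℕ) : ℤ)) (20 * ((fcells κ Φ t p O.merged g f).K : ℤ) * (((fcells κ Φ t p O.merged g f).s 1 : ℕ) : ℤ)) (Dof / 2) (Dof / 2) Dof := rfl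
  have hlipF : Skelφ.Lip G (fineO κ Φ t p O.D O.DT O.ori g f) := lip_fine_at κ Φ t p O.merged g f hlip hNL
  have hwsF : Skelφ.WeakSteps G (fineO κ Φ t p O.D O.DT O.ori g f) := weakSteps_fine_at κ Φ t p O.merged g f hstep hNL
  have hF0 : fineO κ Φ t p O.D O.DT O.ori g f t = 0 := fine_base_at κ Φ t p O.merged g f (φL κ Φ t p O.D O.DT O.ori g f) hNL
  have hsc0 : 20 * ((fcells κ Φ t p O.merged g f).K : ℤ) * (((fcells κ Φ t p O.merged g f).s 0 : ℕ) : ℤ) * 800 * (40 * TwoAxis.Para.modulus (nL κ Φ t p O.merged g f) (hL κ Φ t p O.merged g f) (vL κ Φ t p O.merged g f) vβ) = ((fcells κ Φ t p O.merged g f).r 0 : ℤ) * Dof :=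
    hsc_R κ Φ t p O.merged g f 0
  have hsc1 : 20 * ((fcells κ Φ t p O.merged g f).K : ℤ) * (((fcells κ Φ t p O.merged g f).s 1 : ℕ) : ℤ) * 800 * (40 * TwoAxis.Para.modulus (nL κ Φ t p O.merged g f) (hL κ Φ t p O.merged g f) (vL κ Φ t p O.merged g f) vβ) = ((fcells κ Φ t p O.merged g f).r 1 : ℤ) * Dof :=
    hsc_R κ Φ t p O.merged g f 1
  -- ### the schedule of record and its columns
  have hΛ : Skelφ.WFS2 (fcells κ Φ t p O.merged g f) (schedOf κ Φ t p O.merged g f (SU ex mx κ Φ t p O.merged g f q)) := schedOf_WFS2 κ Φ t p O.merged g f _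
  have hgap : ∀ m, 20 * (fcells κ Φ t p O.merged g f).rmax ≤ Skelφ.Prm.gap (SU ex mx κ Φ t p O.merged g f q) m := hgap20_U κ Φ t p O.merged g f ex mx q
  have hgapc : ∀ m, cOff κ Φ t p O.merged g f ≤ Skelφ.Prm.gap (SU ex mx κ Φ t p O.merged g f q) m := hgapc_U κ Φ t p O.merged g f ex mx q
  have hoff : ∀ x : Site 2, offN κ Φ t p O.merged g f x ≤ cOff κ Φ t p O.merged g f * ((x 0).natAbs + (x 1).natAbs) + 1 :=
    offN_le κ Φ t p O.merged g f hNL hκL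
  have hE₀ : 3 ≤ Skelφ.Prm.E₀ (SU ex mx κ Φ t p O.merged g f q) := (three_le_E₀_U κ Φ t p O.merged g f ex mx q).1
  have hgapL : ∀ ρ, Skelφ.Prm.Lp (SU ex mx κ Φ t p O.merged g f q) ≤ Skelφ.Prm.gap (SU ex mx κ Φ t p O.merged g f q) ρ := hgapL_U κ Φ t p O.merged g f ex mx q
  obtain ⟨hexL, hLE⟩ := ex_le_Lp_U κ Φ t p O.merged g f ex mx q
  have hcol : ∀ a x, ∃ y ∈ Skelφ.VWin G (fineO κ Φ t p O.D O.DT O.ori g f) t ((fcells κ Φ t p O.merged g f).Q x) ((schedOf κ Φ t p O.merged g f (SU ex mx κ Φ t p O.merged g f q)).rQ a x),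
      fineO κ Φ t p O.D O.DT O.ori g f y = (fcells κ Φ t p O.merged g f).cen x := fun a x =>
    ⟨colV κ Φ t p O.merged g f hlip hstep hNL x, colV_mem_VWin_schedOf κ Φ t p O.merged g f hlip hstep hNL _ a x, colV_eq κ Φ t p O.merged g f hlip hstep hNL x⟩
  have hcF : ∀ (a : ℕ) (y : Site 2), fineO κ Φ t p O.D O.DT O.ori g f (colV κ Φ t p O.merged g f hlip hstep hNL y) = (fcells κ Φ t p O.merged g f).cen y := fun _ y =>
    colV_eq κ Φ t p O.merged g f hlip hstep hNL y
  have hcQ : ∀ (a : ℕ) (y : Site 2), colV κ Φ t p O.merged g f hlip hstep hNL y ∈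
      Skelφ.VWin G (fineO κ Φ t p O.D O.DT O.ori g f) t ((fcells κ Φ t p O.merged g f).Q y) ((schedOf κ Φ t p O.merged g f (SU ex mx κ Φ t p O.merged g f q)).rQ a y) := fun a y =>
    colV_mem_VWin_schedOf κ Φ t p O.merged g f hlip hstep hNL _ a y
  have hcD : ∀ (a : ℕ) (y : Site 2), colV κ Φ t p O.merged g f hlip hstep hNL y ∈
      graphBall G t (cOff κ Φ t p O.merged g f * ((y 0).natAbs + (y 1).natAbs) + 1) := fun _ y =>
    colV_mem_graphBall κ Φ t p O.merged g f hlip hstep hNL hκL y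
  -- ### the frame change and the five primitive floors
  have ha := ha_T κ Φ t p O.merged g f hNL
  have hBx := hBx_T κ Φ t p O.merged g f hNL
  have hb' := hb_T κ Φ t p O.merged g f
  obtain ⟨-, -, hbL1⟩ := aWT_nonneg κ Φ t p O.merged g f hNL
  have P3 : ((Skelφ.CorrRec.WA (nL κ Φ t p O.merged g f) (aWT κ Φ t p O.merged g f) : ℕ) : ℤ) ≤ 24 * ((nL κ Φ t p O.merged g f) : ℤ) := by
    have h := aWT_le κ Φ t p O.merged g f hNL
    have h' : (aWT κ Φ t p O.merged g f).toNat ≤ 24 * (nL κ Φ t p O.merged g f) := Int.toNat_le.2 (by push_cast; exact h)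
    have h'' : Skelφ.CorrRec.WA (nL κ Φ t p O.merged g f) (aWT κ Φ t p O.merged g f) ≤ 24 * (nL κ Φ t p O.merged g f) := by
      unfold Skelφ.CorrRec.WA; exact max_le (by omega) h'
    exact_mod_cast h''
  have P4 : (shearUnit (nL κ Φ t p O.merged g f) (hL κ Φ t p O.merged g f) : ℤ) * (((Skelφ.CorrRec.L0A (bLT κ Φ t p O.merged g f) : ℕ) : ℤ) + 1) ≤ 12 * TwoAxis.Para.modulus (nL κ Φ t p O.merged g f) (hL κ Φ t p O.merged g f) (vL κ Φ t p O.merged g f) vβ := by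
    have h := U_bLT_le κ Φ t p O.merged g f hNL hκL hℓ24
    have e : ((Skelφ.CorrRec.L0A (bLT κ Φ t p O.merged g f) : ℕ) : ℤ) = bLT κ Φ t p O.merged g f := by
      unfold Skelφ.CorrRec.L0A; exact Int.toNat_of_nonneg (by linarith)
    rw [e]; exact h
  have P5 : ∀ i, (fcells κ Φ t p O.merged g f).r i ≤ 4 * b0T κ Φ t p O.merged g f i := fun i => (r_le_four_b0T κ Φ t p O.merged g f i).1
  have hbr : ∀ i, ((b0T κ Φ t p O.merged g f i : ℕ) : ℤ) ≤ 2 * ((fcells κ Φ t p O.merged g f).r i : ℤ) := fun i => by exact_mod_cast (r_le_four_b0T κ Φ t p O.merged g f i).2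
  have hE₀Z : 1 + (10 + 3) * (800 * ((nL κ Φ t p O.merged g f) + Skelφ.CorrRec.Qw (nL κ Φ t p O.merged g f) (ℓL κ Φ t p O.merged g f) (hL κ Φ t p O.merged g f))) + 3 ≤ Skelφ.Prm.E₀ (SU ex mx κ Φ t p O.merged g f q) := by omega
  -- ### levels and the apron kit of record (runX frame: `A := (M_u+1)·U_L + 1`, `r₀ := r₀A(Rl)`)
  have hRA := KS.RA'_eq κ Φ t p O.merged mk
  have hRl : KS.RlevA κ Φ t p O.merged mk + 1 ≤ KS.RA' κ Φ t p O.merged mk := hRA.2.1.le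
  have hj : KS.j₁A κ Φ t p O.merged mk ≤ KS.RlevA κ Φ t p O.merged mk := hRA.2.2
  let Pk : Skelφ.ApronPrm := KS.apron Φ t O.merged mk ((Mu O.merged + 1 : ℕ) * (shearUnit (nL κ Φ t p O.merged g f) (hL κ Φ t p O.merged g f) : ℤ) + 1) (KS.r₀A Φ t O.merged mk Rl)
  obtain ⟨hPN, hd1, hD1, hD2, hDρ, hℓk, hWk, hKmax, hKCmax, hR', hT, hT'⟩ :=
    KS.apron_ok Φ t O.merged mk ((Mu O.merged + 1 : ℕ) * (shearUnit (nL κ Φ t p O.merged g f) (hL κ Φ t p O.merged g f) : ℤ) + 1) (KS.r₀A Φ t O.merged mk Rl) (c := 10 + 1) (by norm_num)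
  obtain ⟨hrs, hcS⟩ := KS.apron_sizes Φ t O.merged mk ((Mu O.merged + 1 : ℕ) * (shearUnit (nL κ Φ t p O.merged g f) (hL κ Φ t p O.merged g f) : ℤ) + 1) (KS.r₀A Φ t O.merged mk Rl)
  have hr₀ := KS.hr₀_apron Φ t O.merged mk ((Mu O.merged + 1 : ℕ) * (shearUnit (nL κ Φ t p O.merged g f) (hL κ Φ t p O.merged g f) : ℤ) + 1) (KS.r₀A_ge Φ t O.merged mk Rl).1
  have hRlreach := KS.hreach_apron Φ t O.merged mk ((Mu O.merged + 1 : ℕ) * (shearUnit (nL κ Φ t p O.merged g f) (hL κ Φ t p O.merged g f) : ℤ) + 1) (KS.r₀A_ge Φ t O.merged mk Rl).2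
  have hR'k : Skelφ.cylRadMax G (φL κ Φ t p O.D O.DT O.ori g f) Φ.types Pk.ℓ (KS.Rs t O.merged mk + KS.KCmax t O.merged mk + (Pk.W + KS.Kmax t O.merged mk)) ≤ Pk.R' := by
    unfold NegB.φL; rw [Skelφ.cylRadMax_oriφ]; exact hR'
  have hj₀T := KS.j₀A_ge Φ t O.merged mk ((Mu O.merged + 1 : ℕ) * (shearUnit (nL κ Φ t p O.merged g f) (hL κ Φ t p O.merged g f) : ℤ) + 1) (KS.r₀A Φ t O.merged mk Rl)
  have hjreach := rootKit_reach κ Φ t p O.merged mk ((Mu O.merged + 1 : ℕ) * (shearUnit (nL κ Φ t p O.merged g f) (hL κ Φ t p O.merged g f) : ℤ) + 1) (KS.r₀A Φ t O.merged mk Rl)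
  have hr₀L : Pk.r₀ + 3 ≤ Skelφ.Prm.Lp (SU ex mx κ Φ t p O.merged g f q) := le_trans hex₁ hexL
  -- counts at accuracy `κ.δ`
  obtain ⟨hk, hcount⟩ := KS.counts_R κ Φ t p O.merged mk hp0 hp1 hq1 hq2 (Neg.δkit_le_δ κ Φ)
  have hkN := KS.hNk_at κ Φ t p O.merged mk hp0 hp1
  have hδ0 : 0 < κ.δ := κ.hδ0
  have hδI : Neg.δI κ Φ ≤ κ.δ ^ 2 := Neg.δI_le_sq_of_le κ Φ (Neg.δkit_le_δ κ Φ)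
  have hη : Neg.η κ Φ ≤ κ.δ / 2 := by linarith [(Neg.η_pos κ Φ).2.1, Neg.δkit_le_δ κ Φ]
  -- ### the kit pair's region and exit table
  have hQKf := fun c => KS.QKO_facts κ Φ t p O.D O.DT O.ori g f mk c
  have hRgRs : ∀ c, (KS.QKO κ Φ t p O.D O.DT O.ori g f mk).RS c ≤ KS.Rs t O.merged mk := fun c => by rw [(hQKf c).2.2.2.1]; exact (KS.RK_le_Rs t O.merged mk).1
  have hRg : ∀ c, ∀ u ∈ RgO G (φL κ Φ t p O.D O.DT O.ori g f) (KS.QKO κ Φ t p O.D O.DT O.ori g f mk) c, u ∈ graphBall G c (KS.Rs t O.merged mk) := fun c u hu =>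
    graphBall_mono G c (hRgRs c) (Skelφ.RgO_subset_graphBall (KS.QKO κ Φ t p O.D O.DT O.ori g f mk) c u hu)
  have hRgcard : ∀ c, (RgO G (φL κ Φ t p O.D O.DT O.ori g f) (KS.QKO κ Φ t p O.D O.DT O.ori g f mk) c).card ≤ KS.cUA Φ t O.merged mk := fun c => by
    rw [KS.RgO_QKO]; exact KS.card_RgK_le Φ t O.merged mk _ c
  have hcU1 := KS.hcU1_at Φ t O.merged mk
  have hQ : ∀ c, (KS.QKO κ Φ t p O.D O.DT O.ori g f mk).nS c = KS.nKit O.merged mk ∧ (KS.QKO κ Φ t p O.D O.DT O.ori g f mk).hS c = O.merged.hgt t (KS.MK O.merged mk) (KS.nKit O.merged mk) ∧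
      (KS.QKO κ Φ t p O.D O.DT O.ori g f mk).ℓS c = O.merged.len t (KS.MK O.merged mk) (KS.nKit O.merged mk) ∧
      (KS.QKO κ Φ t p O.D O.DT O.ori g f mk).RS c = O.merged.R (O.merged.scale t (KS.MK O.merged mk) (KS.nKit O.merged mk)) ∧
      (KS.QKO κ Φ t p O.D O.DT O.ori g f mk).vS c = O.merged.spl t (KS.MK O.merged mk) (KS.nKit O.merged mk) := fun c => ⟨rfl, rfl, rfl, rfl, rfl⟩
  have hPex : ∀ (cb : V) (Lo Hi : Site 2) (i : Fin 2) (σ₀ : ℤˣ) (c : V), ∀ v ∈ pexXO G (φL κ Φ t p O.D O.DT O.ori g f) (KS.QKO κ Φ t p O.D O.DT O.ori g f mk) (Mu O.merged) (nL κ Φ t p O.merged g f) (hL κ Φ t p O.merged g f) Pk.A 1 i σ₀ c,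
      v ∈ RgO G (φL κ Φ t p O.D O.DT O.ori g f) (KS.QKO κ Φ t p O.D O.DT O.ori g f mk) c ∧
      (Skelφ.runXSideU (φ := (φL κ Φ t p O.D O.DT O.ori g f)) cb hnL (hL κ Φ t p O.merged g f) (Or.inl rfl) Lo Hi i σ₀).lin ((φL κ Φ t p O.D O.DT O.ori g f) v) + Pk.A +
        ((Skelφ.runXSideU (φ := (φL κ Φ t p O.D O.DT O.ori g f)) cb hnL (hL κ Φ t p O.merged g f) (Or.inl rfl) Lo Hi i σ₀).s : ℤ) *
          Skelφ.coef (Skelφ.runXSideU (φ := (φL κ Φ t p O.D O.DT O.ori g f)) cb hnL (hL κ Φ t p O.merged g f) (Or.inl rfl) Lo Hi i σ₀).cα (Skelφ.runXSideU (φ := (φL κ Φ t p O.D O.DT O.ori g f)) cb hnL (hL κ Φ t p O.merged g f) (Or.inl rfl) Lo Hi i σ₀).cβ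
            (Skelφ.runXSideU (φ := (φL κ Φ t p O.D O.DT O.ori g f)) cb hnL (hL κ Φ t p O.merged g f) (Or.inl rfl) Lo Hi i σ₀).a ≤
      (Skelφ.runXSideU (φ := (φL κ Φ t p O.D O.DT O.ori g f)) cb hnL (hL κ Φ t p O.merged g f) (Or.inl rfl) Lo Hi i σ₀).lin ((φL κ Φ t p O.D O.DT O.ori g f) c) := fun cb Lo Hi i σ₀ c =>
    Skelφ.pexXO_spec cb hnL (hL κ Φ t p O.merged g f) (Or.inl rfl) hκL10 Lo Hi (KS.QKO κ Φ t p O.D O.DT O.ori g f mk) rfl hnSK hκSK hℓSK i σ₀ c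
  -- ### the zone family
  have hkM : O.merged.k ≤ Mu O.merged := hkM₀
  have hkn : ∀ c, O.merged.Λ c O.merged.k ⊆ O.merged.Λ c (Mu O.merged) := fun c => by
    rw [hΛeq]; exact Skelφ.fatSeq_monotone Φ.frame hC c hkM
  have hZφ : ∀ c, (↑(O.merged.Λ c (Mu O.merged)) : Set V) ⊆ Skelφ.cyl Φ.φ c (Mu O.merged) := fun c => by
    rw [hΛeq]; exact Skelφ.fatSeq_subset_cyl Φ.frame hC c _
  have hZc : ∀ c, (↑(O.merged.Λ c (Mu O.merged)) : Set V) ⊆ Skelφ.cyl (φL κ Φ t p O.D O.DT O.ori g f) c (Mu O.merged) := fun c => by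
    unfold NegB.φL; rw [Skelφ.cyl_oriφ]; exact hZφ c
  have hΛRg := KS.hΛRg_of_atQOS mk hAtS
  have hΛz : ∀ c, ∀ v ∈ O.merged.Λ c (Mu O.merged), v ∈ RgO G (φL κ Φ t p O.D O.DT O.ori g f) (KS.QKO κ Φ t p O.D O.DT O.ori g f mk) c ∧ (φL κ Φ t p O.D O.DT O.ori g f) v - (φL κ Φ t p O.D O.DT O.ori g f) c ∈ box 2 (Mu O.merged) := fun c v hv => by
    refine ⟨?_, ?_⟩
    · rw [KS.RgO_QKO]; exact hΛRg c hv
    · exact (Skelφ.mem_cyl (φ := (φL κ Φ t p O.D O.DT O.ori g f)) c (Mu O.merged) v).1 (hZc c (Finset.mem_coe.2 hv))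
  have hMz : Mu O.merged < (nL κ Φ t p O.merged g f) := lt_of_le_of_lt (Mu_le_ML κ Φ t p O.merged g) (ML_lt_nL κ Φ t p O.merged g f).1
  -- ### the Step-I″ inputs at every centre
  have hzone : ∀ c, 1 - κ.δ ^ 2 < (bondPercolation G q).real (UniqZone.zone G (O.merged.Λ c) O.merged.k (Mu O.merged)) :=
    fun c => lt_of_le_of_lt (by linarith [hδI]) (zoneAt_of_atQOB hAtB h1 c)
  have hservedK : ∀ (c : V) (fam : Fin 2) (σ' τ' : ℤˣ), 1 - κ.δ ^ 2 < (bondPercolation G q).real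
      (linkIn (Skelφ.StepI.regionNAt G (oriφ (φL κ Φ t p O.D O.DT O.ori g f) ((KS.QKO κ Φ t p O.D O.DT O.ori g f mk).oS c)) O.merged t c (KS.MK O.merged mk) (KS.nKit O.merged mk))
        (O.merged.Λ c O.merged.k) (Skelφ.StepI.pieceNAt G (oriφ (φL κ Φ t p O.D O.DT O.ori g f) ((KS.QKO κ Φ t p O.D O.DT O.ori g f mk).oS c)) O.merged t c (KS.MK O.merged mk) (KS.nKit O.merged mk) fam σ' τ')) := by
    intro c fam σ' τ'
    have h := inputsExtraAt_of_atQOB hAtB h1 c hPk fam σ' τ'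
    rw [Skelφ.StepI.eventNAt_some] at h
    have hmap : oriφ (φL κ Φ t p O.D O.DT O.ori g f) ((KS.QKO κ Φ t p O.D O.DT O.ori g f mk).oS c) = oriφ Φ.φ (O.ori t (KS.MK O.merged mk) (KS.nKit O.merged mk)) := by
      rw [(hQKf c).2.2.2.2.2, KS.oriφ_φL_oS]; rfl
    rw [hmap]
    exact lt_of_le_of_lt (by linarith [hδI]) h
  have hexit := Skelφ.real_pexXO_gt (φ := (φL κ Φ t p O.D O.DT O.ori g f)) (Λ := O.merged.Λ) (k := O.merged.k) hQ hservedK (Mu O.merged) (nL κ Φ t p O.merged g f) (hL κ Φ t p O.merged g f) Pk.A (Or.inl rfl : (1 : ℤ) = 1 ∨ (1 : ℤ) = -1)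
  have hlongT : ∀ c (σ τ : ℤ), σ = 1 ∨ σ = -1 → τ = 1 ∨ τ = -1 → 1 - κ.δ ^ 2 < (bondPercolation G q).real
      (linkIn (Skelφ.pgramPrism G (φL κ Φ t p O.D O.DT O.ori g f) c (nL κ Φ t p O.merged g f) (hL κ Φ t p O.merged g f) (3 * (ℓL κ Φ t p O.merged g f)) Rl) (O.merged.Λ c O.merged.k) (pgTopPieceW G (φL κ Φ t p O.D O.DT O.ori g f) c (nL κ Φ t p O.merged g f) (hL κ Φ t p O.merged g f) (ℓL κ Φ t p O.merged g f) Rl σ τ (vL κ Φ t p O.merged g f))) := by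
    intro c σ τ hσ hτ
    have h := hInL c 1 (Skelφ.sgnU σ) (Skelφ.sgnU τ)
    rw [Skelφ.StepI.eventNAt_some] at h
    unfold Skelφ.StepI.regionNAt Skelφ.StepI.pieceNAt at h
    rw [if_neg (by decide), Skelφ.val_sgnU hσ, Skelφ.val_sgnU hτ] at h
    exact lt_of_le_of_lt (by linarith [hδI]) h
  have hlongS : ∀ c (σ τ : ℤ), σ = 1 ∨ σ = -1 → τ = 1 ∨ τ = -1 → 1 - κ.δ ^ 2 < (bondPercolation G q).real
      (linkIn (Skelφ.pgramPrism G (φL κ Φ t p O.D O.DT O.ori g f) c (nL κ Φ t p O.merged g f) (hL κ Φ t p O.merged g f) (3 * (ℓL κ Φ t p O.merged g f)) Rl) (O.merged.Λ c O.merged.k) (pgSideHalfW G (φL κ Φ t p O.D O.DT O.ori g f) c (nL κ Φ t p O.merged g f) (hL κ Φ t p O.merged g f) (ℓL κ Φ t p O.merged g f) Rl σ (σ * τ))) := by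
    intro c σ τ hσ hτ
    have hστ : σ * τ = 1 ∨ σ * τ = -1 := by rcases hσ with h | h <;> rcases hτ with h' | h' <;> simp [h, h']
    have h := hInL c 0 (Skelφ.sgnU σ) (Skelφ.sgnU (σ * τ))
    rw [Skelφ.StepI.eventNAt_some] at h
    unfold Skelφ.StepI.regionNAt Skelφ.StepI.pieceNAt at h
    rw [if_pos rfl, Skelφ.val_sgnU hσ, Skelφ.val_sgnU hστ] at h
    exact lt_of_le_of_lt (by linarith [hδI]) h
  -- ### the excess at the value (fine diameter `50·rmax` ⇒ planar diameter `mR`)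
  have hRex : ∀ R₀' R₁, Rex κ Φ (mR κ Φ t p O.merged g f (mx κ Φ t p O.merged g f)) q R₀' ≤ R₁ → ∀ (Rw : ℕ) (D' A' : Finset V),
      (∀ d ∈ D', d ∈ graphBall G t Rw) → (∀ d ∈ D', ∀ d' ∈ D', fineO κ Φ t p O.D O.DT O.ori g f d - fineO κ Φ t p O.D O.DT O.ori g f d' ∈ box 2 (50 * (fcells κ Φ t p O.merged g f).rmax)) →
        A' ⊆ D' → (∀ a ∈ A', a ∈ graphBall G t R₀') → (bondPercolation G q).real (Skel.excess G t R₁ D' A') ≤ Neg.η κ Φ :=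
    fun R₀' R₁ hR Rw D' A' hD hbox hA hA' =>
      hRex_U κ Φ t p O.merged g f ex mx q hCq (oL κ Φ t p O.D O.DT O.ori g f) le_rfl t R₀' R₁ hR Rw D' A' hD
        (fun d hd d' hd' => fine_diam_le_mR κ Φ t p O.merged g f (mx κ Φ t p O.merged g f) hNL (hbox d hd d' hd')) hA hA'
  have hsch := hsch_U κ Φ t p O.merged g f ex mx q
  -- ### assemble
  exact Skelφ.reachOblRHN_negSG₂b_of_floors hfr hκc Φ.degree_le hstep hlip hAf hnL hm hc0' hc1' hDf hκL _ hfine hlipF hwsF hF0 (fcells κ Φ t p O.merged g f) _ _ _ _ _ q κ.δ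
    (b0T κ Φ t p O.merged g f) (b0T_le κ Φ t p O.merged g f) hΛ hgap hgapc hoff hE₀ hgapL hcol (fun _ y => colV κ Φ t p O.merged g f hlip hstep hNL y) hcF hcQ hcD
    hgapc hvn hlay (KS.RA' κ Φ t p O.merged mk) ha hBx hb' hΔlo hΔhi hsc0 hsc1 P1 P2 P3 P4 P5 hbr hE₀Z hRl hj hcount hη hRex hsch
    Pk (le_trans (by norm_num) hPN) rfl hd1 hD1 hD2 hDρ hℓk hWk hKmax hKCmax hR'k hT hT' hr₀ hrs hcS hj₀T hjreach hRlreach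
    (fun c => RgO G (φL κ Φ t p O.D O.DT O.ori g f) (KS.QKO κ Φ t p O.D O.DT O.ori g f mk) c) hRg hRgcard hcU1 O.merged.Λ hkn hΛz hZc hMz hclear
    (fun i σ₀ c => pexXO G (φL κ Φ t p O.D O.DT O.ori g f) (KS.QKO κ Φ t p O.D O.DT O.ori g f mk) (Mu O.merged) (nL κ Φ t p O.merged g f) (hL κ Φ t p O.merged g f) Pk.A 1 i σ₀ c) hPex (KS.kkA κ Φ t p O.merged mk) hkN hk hδ0 hr₀L hLE hzone hexit hlongT hlongS

/-! ## §2 At the box / width / pair slots of record `(gT, fT, PR)`: only the two `ex` floors remain -/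

/-- **THE (C) RESIDUE OF THE CHOICES OF RECORD AT `(O, q)` FOR THE SLOTS OF RECORD** `gv := KS.gT mk gx`, `fv := KS.fT mk fx`, `Pv := KS.PR mk Px`,
`Sv := SU ex mx`: modulo the two floors on `ex`. [cite: KozmaNitzan2024, §4 Lemmas 10–12 (pp. 17–25)] -/
theorem reachOblRHN_negBT_at {mk : ℕ} {gx fx : Neg.FSlot} {Px : PSlot}
    (hAt : (choiceAtOT κ Φ t p (KS.gT mk gx) (KS.fT mk fx) (SU ex mx) hC (KS.PR mk Px)).AtQO O q) (h1 : Φ.types = {t}) (hp0 : 0 < (p : ℝ)) (hp1 : (p : ℝ) < 1)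
    (hex₁ : KS.r₀A Φ t O.merged mk (O.merged.R (O.merged.scale t (ML κ Φ t p O.merged (KS.gT mk gx κ Φ t p O.merged))
        (nL κ Φ t p O.merged (KS.gT mk gx κ Φ t p O.merged) (KS.fT mk fx κ Φ t p O.merged)))) + 3 ≤
      ex κ Φ t p O.merged (KS.gT mk gx κ Φ t p O.merged) (KS.fT mk fx κ Φ t p O.merged))
    (hex₂ : 4 + 13 * (800 * (nL κ Φ t p O.merged (KS.gT mk gx κ Φ t p O.merged) (KS.fT mk fx κ Φ t p O.merged) +
        Skelφ.CorrRec.Qw (nL κ Φ t p O.merged (KS.gT mk gx κ Φ t p O.merged) (KS.fT mk fx κ Φ t p O.merged))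
          (ℓL κ Φ t p O.merged (KS.gT mk gx κ Φ t p O.merged) (KS.fT mk fx κ Φ t p O.merged))
          (hL κ Φ t p O.merged (KS.gT mk gx κ Φ t p O.merged) (KS.fT mk fx κ Φ t p O.merged)))) ≤
      ex κ Φ t p O.merged (KS.gT mk gx κ Φ t p O.merged) (KS.fT mk fx κ Φ t p O.merged)) :
    Skel.ReachOblRHN G Skel.nmaxN ((choiceAtOT κ Φ t p (KS.gT mk gx) (KS.fT mk fx) (SU ex mx) hC (KS.PR mk Px)).scheme O q)
      ((choiceAtOT κ Φ t p (KS.gT mk gx) (KS.fT mk fx) (SU ex mx) hC (KS.PR mk Px)).FD O q) Φ.Δ κ.δ := by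
  have hEqL := clauseL_of_atQOT hAt
  have hNL : EqNumL κ Φ t p O.merged (KS.gT mk gx κ Φ t p O.merged) (KS.fT mk fx κ Φ t p O.merged) := eqNumL_of_atQOT hAt
  have hκL : (hL κ Φ t p O.merged (KS.gT mk gx κ Φ t p O.merged) (KS.fT mk fx κ Φ t p O.merged)).natAbs ≤
      10 * nL κ Φ t p O.merged (KS.gT mk gx κ Φ t p O.merged) (KS.fT mk fx κ Φ t p O.merged) := hEqL.2
  obtain ⟨-, P2⟩ := KS.corridor_floors_T κ Φ t p O.merged mk gx fx hNL hκL
  have hlayT := KS.layer_T κ Φ t p O.merged mk gx (KS.fT mk fx κ Φ t p O.merged) hNL hκL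
  have hℓ := KS.ℓL_ge_T κ Φ t p O.merged mk gx (KS.fT mk fx κ Φ t p O.merged) hNL
  have hclr := KS.hclrz_T κ Φ t p O.merged mk gx (KS.fT mk fx κ Φ t p O.merged) hNL hκL
  have hU0 : (0 : ℤ) ≤ ((nL κ Φ t p O.merged (KS.gT mk gx κ Φ t p O.merged) (KS.fT mk fx κ Φ t p O.merged) +
      (hL κ Φ t p O.merged (KS.gT mk gx κ Φ t p O.merged) (KS.fT mk fx κ Φ t p O.merged)).natAbs : ℕ) : ℤ) := Nat.cast_nonneg _
  have hR0 : (0 : ℤ) ≤ (KS.RA' κ Φ t p O.merged mk : ℤ) := Nat.cast_nonneg _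
  have h24 : (24 : ℤ) ≤ ℓL κ Φ t p O.merged (KS.gT mk gx κ Φ t p O.merged) (KS.fT mk fx κ Φ t p O.merged) := by linarith
  have hclr' : (((Mu O.merged + 4) * (nL κ Φ t p O.merged (KS.gT mk gx κ Φ t p O.merged) (KS.fT mk fx κ Φ t p O.merged) +
        (hL κ Φ t p O.merged (KS.gT mk gx κ Φ t p O.merged) (KS.fT mk fx κ Φ t p O.merged)).natAbs) : ℕ) : ℤ) ≤
      ((nL κ Φ t p O.merged (KS.gT mk gx κ Φ t p O.merged) (KS.fT mk fx κ Φ t p O.merged) *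
        (ℓL κ Φ t p O.merged (KS.gT mk gx κ Φ t p O.merged) (KS.fT mk fx κ Φ t p O.merged) + 1) : ℕ) : ℤ) := by
    push_cast [Int.natCast_natAbs]; exact hclr
  exact reachOblRHN_negBT_SU hAt h1 hp0 hp1 mk (KS.kit_mem_PR κ Φ t p O.merged mk Px) (g := KS.gT mk gx κ Φ t p O.merged)
    (f := KS.fT mk fx κ Φ t p O.merged) rfl rfl
    (KS.nL_floorsT κ Φ t p O.merged mk fx (KS.gT mk gx κ Φ t p O.merged)).2.1 P2 (by nlinarith [hlayT, hU0, hR0]) (by exact_mod_cast h24)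
    (by exact_mod_cast hclr') hex₁ hex₂

end AtQ

end NegB

/-! ## §3 `ReachHoldsRHNOFn` of the choice function of record -/

/-- **`ReachHoldsRHNOFn (negChoiceAllOT (KS.gT mk gx) (KS.fT mk fx) (KS.PR mk Px) (NegB.SU ex mx))`** — the (C) hypothesis of
`samePDropOfSkeletonNeg₁_of_choiceFnNO` for the choice function of record, for every kit index `mk` and all residual slot functions `gx fx Px mx`, as soon
as the residual depth slot `ex` clears the two corridor floors at every record: `r₀A(R_l) + 3 ≤ ex` and `4 + 13·800·(n_L + W_B) ≤ ex`
(`W_B = CorrRec.Qw n_L ℓ_L h_L = n_Lℓ_L/U_L + 1`). [cite: KozmaNitzan2024, §4 Theorem 6 (pp. 25–31), Lemmas 10–12] -/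
theorem reachHoldsRHNOFn_negChoiceAllOT (mk : ℕ) (gx fx : Neg.FSlot) (Px : NegB.PSlot) (ex mx : NegB.GSlot)
    (hex : ∀ (κ : Consts) {V : Type} [DecidableEq V] [Countable V] {G : SimpleGraph V} [G.LocallyFinite] (Φ : PlanarSkeletonNeg G) (t : V) (p : unitInterval)
      (D : DataN V),
      NegB.KS.r₀A Φ t D mk (D.R (D.scale t (NegB.ML κ Φ t p D (NegB.KS.gT mk gx κ Φ t p D))
          (NegB.nL κ Φ t p D (NegB.KS.gT mk gx κ Φ t p D) (NegB.KS.fT mk fx κ Φ t p D)))) + 3 ≤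
        ex κ Φ t p D (NegB.KS.gT mk gx κ Φ t p D) (NegB.KS.fT mk fx κ Φ t p D) ∧
      4 + 13 * (800 * (NegB.nL κ Φ t p D (NegB.KS.gT mk gx κ Φ t p D) (NegB.KS.fT mk fx κ Φ t p D) +
          Skelφ.CorrRec.Qw (NegB.nL κ Φ t p D (NegB.KS.gT mk gx κ Φ t p D) (NegB.KS.fT mk fx κ Φ t p D))
            (NegB.ℓL κ Φ t p D (NegB.KS.gT mk gx κ Φ t p D) (NegB.KS.fT mk fx κ Φ t p D))
            (NegB.hL κ Φ t p D (NegB.KS.gT mk gx κ Φ t p D) (NegB.KS.fT mk fx κ Φ t p D)))) ≤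
        ex κ Φ t p D (NegB.KS.gT mk gx κ Φ t p D) (NegB.KS.fT mk fx κ Φ t p D)) :
    ReachHoldsRHNOFn (negChoiceAllOT (NegB.KS.gT mk gx) (NegB.KS.fT mk fx) (NegB.KS.PR mk Px) (NegB.SU ex mx)) := by
  refine reachHoldsRHNOFn_negChoiceAllOT_of _ _ _ _ ?_
  intro κ V _ _ _ _ Φ t p _ O _ hAt h1 hp0 hp1
  exact NegB.reachOblRHN_negBT_at hAt h1 hp0 hp1 (hex κ Φ t p O.merged).1 (hex κ Φ t p O.merged).2

end PlanarSkeletonNeg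

end Summit.CriticalPhenomena.PercolationContinuityZ3.Theorems.Transplant

end
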